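import Summits.AnomalousDissipation.AnomalousDissipation.Theorems.SawtoothPulseCascadeK1LocalisedCascadeKHLineKernelFourier
import Summits.AnomalousDissipation.AnomalousDissipation.Theorems.SawtoothPulseCascadeK1LocalisedCascadeKHSheetBlock

/-!
# K2 lane (route-2 `SawtoothPulseCascade`, crux dir `K1LocalisedCascade`): the ENERGY of a bare kink-sheet pair IS the Kelvin–Helmholtz Gram form

Helper file of the K2 lane (ACL item stmt-AnomalousDissipation-19491), serving planner p4's typed slot map (`Cruxes/K1LocalisedCascade/K2TypedSlotMap.lean`,
`K2ConeSketch.lean` §0: `coeff`, `energy`, `sheetPair`) and the S2-cert forced step (A26-4 (a)). For `a > 0`, Bloch phase `β` and sheet amplitudes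
`q₊` on `y = ¼`, `q₋` on `y = −¼`, the family energy of the density `q₊δ(y − ¼) + q₋δ(y + ¼)` is
`Σ_{n∈ℤ} |q₊e^{−iπ(β+n)/2} + q₋e^{iπ(β+n)/2}|²/(4π²(a² + (β+n)²)) = (−Σ₀(a,β)(|q₊|² + |q₋|²) − 2 Re(q̄₊ · conj S_β(a) · q₋))/(2π)`
(`sheetPair_energy_hasSum`; the two Mittag-Leffler sums of `…KHLineKernelFourier`), i.e. **`energy a β (sheetPair q₊ q₋) = khForm a (−β) (q₊, q₋)/(2π)`**
in p4's names (`sheetPair_energy_hasSum'`, with `sawSigma0_neg_bloch`, `sawS_neg_bloch`: `Σ₀(a,−β) = Σ₀(a,β)`, `S_{−β} = conj S_β` — p4's convention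
`blockX a β = khField a (−β)`). Consequence: the certified homogeneous sheet-block bound `KHSheetAbsolute 8 16` (`sheet_energy_le_sixteen`, p683995) and the
operator form `‖P(t)‖_M ≤ 16` (p685528) are statements about the kinetic ENERGY of the sheet pair, with no comparison constant; and the energy of a
sheet pair is bounded below by `(−Σ₀ − |S|)(|q₊|² + |q₋|²)/(2π)` (`sheetPair_energy_ge`, from `khGram_ge` p678850).
No definitions; no statement about the crux. [cite: Drazin2002, §8.3 (8.36)–(8.38)] [problem: turb]
-/

-- `Summit.<Summit>.<Problem>`: single-conjunct summit, the duplicate namespace segment is deliberate.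
set_option linter.dupNamespace false

noncomputable section

namespace Summit.AnomalousDissipation.AnomalousDissipation.Theorems.SawtoothPulseCascade.K2PhaseBudget

open Set Literature.Analysis.FluidPDE.SawtoothCascade

/-! ## §1 The Bloch sign: `Σ₀(a,−β) = Σ₀(a,β)`, `S_{−β}(a) = conj S_β(a)` -/

/-- `Σ₀(a, −β) = Σ₀(a, β)` (the diagonal lattice sum is even in the Bloch phase). [cite: Drazin2002, §8.3 (8.36)–(8.38)] -/
theorem sawSigma0_neg_bloch (a β : ℝ) : sawSigma0 a (-β) = sawSigma0 a β := by
  simp only [sawSigma0, mul_neg, Real.cos_neg]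

/-- `S_{−β}(a) = conj S_β(a)` (reversing the Bloch phase conjugates the off-diagonal lattice sum; `q` is real). [cite: Drazin2002, §8.3 (8.36)–(8.38)] -/
theorem sawS_neg_bloch (a β : ℝ) : sawS a (-β) = starRingEnd ℂ (sawS a β) := by
  have hz : Complex.exp (((-(2 * Real.pi * β) : ℝ) : ℂ) * Complex.I) = starRingEnd ℂ (Complex.exp (((2 * Real.pi * β : ℝ) : ℂ) * Complex.I)) := by
    rw [← Complex.exp_conj]; congr 1
    simp only [map_mul, Complex.conj_ofReal, Complex.conj_I]; push_cast; ring
  simp only [sawS, mul_neg]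
  rw [hz]
  simp only [map_neg, map_mul, map_add, map_div₀, map_one, map_sub, Complex.conj_ofReal, Complex.conj_conj]

/-! ## §2 The energy of a bare sheet pair -/

/-- `|q₊u + q₋v|² = |q₊|² + |q₋|² + 2 Re(q₊ q̄₋ · u v̄)` for unimodular `u, v`. [folklore] -/
theorem normSq_pair_unimodular (qp qm u v : ℂ) (hu : ‖u‖ = 1) (hv : ‖v‖ = 1) :
    ‖qp * u + qm * v‖ ^ 2 = Complex.normSq qp + Complex.normSq qm + 2 * (qp * starRingEnd ℂ qm * (u * starRingEnd ℂ v)).re := by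
  rw [Complex.sq_norm, Complex.normSq_add, Complex.normSq_mul, Complex.normSq_mul, Complex.normSq_eq_norm_sq u,
    Complex.normSq_eq_norm_sq v, hu, hv]
  simp only [one_pow, mul_one, map_mul]
  congr 2; ring

/-- **Energy of a bare sheet pair = the Kelvin–Helmholtz Gram form / 2π.** For `a > 0`, Bloch phase `β` and sheet amplitudes `q₊` (on `y = ¼`) and
`q₋` (on `y = −¼`), the family energy `Σ_n |ζ̂(n)|²/(4π²(a² + (β+n)²))` of the transverse density `q₊δ(y − ¼) + q₋δ(y + ¼)`
(`ζ̂(n) = q₊e^{−2πi(β+n)/4} + q₋e^{2πi(β+n)/4}`, p4's `coeff`/`energy` of `sheetPair q₊ q₋` spelled out) equals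
`(−Σ₀(a,β)(|q₊|² + |q₋|²) − 2 Re(q̄₊ · conj S_β(a) · q₋))/(2π)` — the tree's `khForm a (−β) (q₊, q₋)` over `2π` (`sawS a (−β) = conj (sawS a β)`,
`sawSigma0_neg_bloch`), consistent with p4's convention `blockX a β = khField a (−β)`. So the certified sheet-block bound `KHSheetAbsolute 8 16`
(`sheet_energy_le_sixteen`, p683995) is a bound on the ENERGY of the evolving sheet pair, with no comparison loss. [cite: Drazin2002, §8.3 (8.36)–(8.38)] -/
theorem sheetPair_energy_hasSum {a : ℝ} (ha : 0 < a) (β : ℝ) (qp qm : ℂ) :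
    HasSum (fun n : ℤ => ‖qp * Complex.exp (-(2 * Real.pi * (β + n) * (1 / 4 : ℝ) : ℝ) * Complex.I) +
          qm * Complex.exp (-(2 * Real.pi * (β + n) * (-(1 / 4 : ℝ)) : ℝ) * Complex.I)‖ ^ 2 / (4 * Real.pi ^ 2 * (a ^ 2 + (β + n) ^ 2)))
      ((-sawSigma0 a β * (Complex.normSq qp + Complex.normSq qm) - 2 * ((starRingEnd ℂ) qp * (starRingEnd ℂ (sawS a β)) * qm).re) /
        (2 * Real.pi)) := by
  -- the two Mittag-Leffler sums
  have h1 := (hasSum_lineWeights ha β).mul_right (Complex.normSq qp + Complex.normSq qm)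
  have h2 := (Complex.hasSum_re ((hasSum_lineWeights_half' ha β).mul_left (qp * starRingEnd ℂ qm))).mul_left 2
  have h := h1.add h2
  -- the value
  have hπ : Real.pi ≠ 0 := Real.pi_ne_zero
  have hπc : (Real.pi : ℂ) ≠ 0 := by exact_mod_cast hπ
  have hv1 : qp * starRingEnd ℂ qm * (-(sawS a β) / (2 * Real.pi)) = (((-(1 / (2 * Real.pi))) : ℝ) : ℂ) * (qp * starRingEnd ℂ qm * sawS a β) := by
    push_cast; field_simp
  have hv2 : ((starRingEnd ℂ) qp * (starRingEnd ℂ (sawS a β)) * qm).re = (qp * starRingEnd ℂ qm * sawS a β).re := by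
    rw [← Complex.conj_re (qp * starRingEnd ℂ qm * sawS a β)]
    simp only [map_mul, Complex.conj_conj]
    ring_nf
  have hval : -sawSigma0 a β / (2 * Real.pi) * (Complex.normSq qp + Complex.normSq qm) +
      2 * (qp * starRingEnd ℂ qm * (-(sawS a β) / (2 * Real.pi))).re =
      (-sawSigma0 a β * (Complex.normSq qp + Complex.normSq qm) - 2 * ((starRingEnd ℂ) qp * (starRingEnd ℂ (sawS a β)) * qm).re) /
        (2 * Real.pi) := by
    rw [hv1, Complex.re_ofReal_mul, hv2]
    field_simp
    ring
  rw [hval] at h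
  refine h.congr_fun fun n => ?_
  -- the summand
  have hu : ‖Complex.exp (-(2 * Real.pi * (β + n) * (1 / 4 : ℝ) : ℝ) * Complex.I)‖ = 1 := by
    rw [← Complex.ofReal_neg]; exact Complex.norm_exp_ofReal_mul_I _
  have hv : ‖Complex.exp (-(2 * Real.pi * (β + n) * (-(1 / 4 : ℝ)) : ℝ) * Complex.I)‖ = 1 := by
    rw [← Complex.ofReal_neg]; exact Complex.norm_exp_ofReal_mul_I _
  have huv : Complex.exp (-(2 * Real.pi * (β + n) * (1 / 4 : ℝ) : ℝ) * Complex.I) *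
      starRingEnd ℂ (Complex.exp (-(2 * Real.pi * (β + n) * (-(1 / 4 : ℝ)) : ℝ) * Complex.I)) =
      Complex.exp (-(Real.pi * ((β : ℂ) + n) * Complex.I)) := by
    rw [← Complex.exp_conj, ← Complex.exp_add]
    congr 1
    simp only [map_mul, Complex.conj_ofReal, Complex.conj_I, map_neg]
    push_cast; ring
  rw [normSq_pair_unimodular qp qm _ _ hu hv, huv,
    show qp * starRingEnd ℂ qm * ((((1 / (4 * Real.pi ^ 2 * (a ^ 2 + (β + n) ^ 2))) : ℝ) : ℂ) *
        Complex.exp (-(Real.pi * ((β : ℂ) + n) * Complex.I))) =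
      (((1 / (4 * Real.pi ^ 2 * (a ^ 2 + (β + n) ^ 2))) : ℝ) : ℂ) * (qp * starRingEnd ℂ qm * Complex.exp (-(Real.pi * ((β : ℂ) + n) * Complex.I)))
      by ring,
    Complex.re_ofReal_mul]
  have hD : (4 * Real.pi ^ 2 * (a ^ 2 + (β + n) ^ 2) : ℝ) ≠ 0 := by positivity
  field_simp

/-- The same with the Bloch sign moved into the tree's symbols: the value is `khForm a (−β) (q₊, q₋)/(2π)` literally
(`−Σ₀(a,−β)(|q₊|² + |q₋|²) − 2 Re(q̄₊ S_{−β}(a) q₋)`, over `2π`). [cite: Drazin2002, §8.3 (8.36)–(8.38)] -/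
theorem sheetPair_energy_hasSum' {a : ℝ} (ha : 0 < a) (β : ℝ) (qp qm : ℂ) :
    HasSum (fun n : ℤ => ‖qp * Complex.exp (-(2 * Real.pi * (β + n) * (1 / 4 : ℝ) : ℝ) * Complex.I) +
          qm * Complex.exp (-(2 * Real.pi * (β + n) * (-(1 / 4 : ℝ)) : ℝ) * Complex.I)‖ ^ 2 / (4 * Real.pi ^ 2 * (a ^ 2 + (β + n) ^ 2)))
      ((-sawSigma0 a (-β) * (Complex.normSq qp + Complex.normSq qm) - 2 * ((starRingEnd ℂ) qp * sawS a (-β) * qm).re) /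
        (2 * Real.pi)) := by
  rw [sawSigma0_neg_bloch, sawS_neg_bloch]
  exact sheetPair_energy_hasSum ha β qp qm

/-- **Corollary (positivity and the Gram comparison, for the record):** the sheet-pair energy is at least `(−Σ₀ − |S|)(|q₊|² + |q₋|²)/(2π) ≥ 0`
(`khGram_ge`, p678850). [cite: Drazin2002, §8.3 (8.36)–(8.38)] -/
theorem sheetPair_energy_ge {a : ℝ} (ha : 0 < a) (β : ℝ) (qp qm : ℂ) :
    (-sawSigma0 a (-β) - Real.sqrt (Complex.normSq (sawS a (-β)))) * (Complex.normSq qp + Complex.normSq qm) / (2 * Real.pi) ≤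
      ∑' n : ℤ, ‖qp * Complex.exp (-(2 * Real.pi * (β + n) * (1 / 4 : ℝ) : ℝ) * Complex.I) +
          qm * Complex.exp (-(2 * Real.pi * (β + n) * (-(1 / 4 : ℝ)) : ℝ) * Complex.I)‖ ^ 2 / (4 * Real.pi ^ 2 * (a ^ 2 + (β + n) ^ 2)) := by
  rw [(sheetPair_energy_hasSum' ha β qp qm).tsum_eq]
  exact div_le_div_of_nonneg_right (khGram_ge ha (-β) qp qm).2 (by positivity)

end Summit.AnomalousDissipation.AnomalousDissipation.Theorems.SawtoothPulseCascade.K2PhaseBudget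

end
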